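import Mathlib
import HarnessLib
import Literature.AlgebraicGeometry.Resolution.Lipman1969RationalSurfaceSingularities
import Literature.AlgebraicGeometry.Resolution.ExceptionalCurvePoints
import Literature.AlgebraicGeometry.Resolution.ExceptionalFibreConnected
import Literature.AlgebraicGeometry.Resolution.ProperBirationalGlobalSections
import Literature.AlgebraicGeometry.Morphisms.CechH2FibreDimOne
import Summits.ResolutionOfSingularities.ResolutionOfSingularities.Theorems.HomologicalConductorNoZenoCaCarriedTower
import Summits.ResolutionOfSingularities.ResolutionOfSingularities.Theorems.HomologicalConductorNoZenoCaPrimaryTower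
import Summits.ResolutionOfSingularities.ResolutionOfSingularities.Theorems.HomologicalConductorNoZenoCarriedPrincipalClosed
import Summits.ResolutionOfSingularities.ResolutionOfSingularities.Theorems.HomologicalConductorNoZenoStageRational
import Summits.ResolutionOfSingularities.ResolutionOfSingularities.Theorems.HomologicalConductorNoZenoLemmaLDischarged
import Summits.ResolutionOfSingularities.ResolutionOfSingularities.Theorems.HomologicalConductorNoZenoG2Assembly
import Summits.ResolutionOfSingularities.ResolutionOfSingularities.Theorems.HomologicalConductorNoZenoFullSheafLocallyFreeGW
import Summits.ResolutionOfSingularities.ResolutionOfSingularities.Theorems.HomologicalConductorNoZenoFullSheafDualCech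

/-!
# Crux `NoZenoR` / `NoZeno` (stmt-ResolutionOfSingularities-19943 / -16483), line `sandwich-cluster`:
# **G4′ `stub_caInvertibleMinRes` — THEOREM A in scheme form, CLOSED BY NAME** (lead res-L0-w44-lead-1)

Route `ResolutionOfSingularities/HomologicalConductor`.  OURS (cell res-hironaka, crux chain W4.4); nothing
here is a statement of the manuscript under review (Hironaka 2017); AI-written, weaker than expert review.

THEOREM A (chain W4.4, paper: res-L0-w44-idea-1 «Q-rat», plan-1 CRUX-PLAN; Lean: this chain): for a SINGULAR
sandwiched stage `T_m` of the canonical `ca`-tower and any minimal resolution `π : X ⟶ Spec T_m`, the ideal sheaf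
`ca(T_m)·𝒪_X` is invertible along the closed fibre — the extension of the cohomology annihilator along every local
structure map `T_m → 𝒪_{X,x}` is principal.  CONDITIONAL on the registered named-fact bundle `hF`
(Cossart–Jannsen–Saito 2020 Thm 1.2, Lipman 1969 (1.2)/(4.1)/(12.1)(i)(ii), Görtz–Wedhorn II 24.44), of which (1.2),
(12.1)(ii) and 24.44 are used.  Assembly of: the CA-layer (res-L0-w44-stub-5, -stub-7, res-D-pv-043: `ca = ⋂ ann End̲(L*)`),
the full-sheaf package G2 (res-D-pv-045 AS stub-8, res-L0-w44-stub-1, res-D-pv-053, res-D-pv-024, stub-4: `End̲ ≃ Ȟ¹`),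
LEMMA L (res-L0-w44-stub-2: annihilators of `Ȟ¹` are carried), the closed-fibre dictionary (stub-3, stub-4), the Ga glue
and stage instantiation (lead), and Gb (res-D-pv-026 AS stub-9: carried ideals of the rational stage are principal,
Lipman (12.1)(ii)).

References: J. Lipman, Publ. IHÉS 36 (1969) [`Lipman1969`]; O. Iyama, M. Wemyss, Math. Z. 265 (2010), Thm 2.7
[`IyamaWemyss2010`]; S. Iyengar, R. Takahashi, IMRN 2016 [`IyengarTakahashi2014`]; U. Görtz, T. Wedhorn,
*Algebraic Geometry II* (2023), Cor. 24.44 [`GortzWedhorn2023`].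
-/

noncomputable section
set_option linter.dupNamespace false

namespace Summit.ResolutionOfSingularities.ResolutionOfSingularities.Theorems.NoZeno.SandwichCluster

open CategoryTheory CategoryTheory.Abelian AlgebraicGeometry TopologicalSpace IsLocalRing
open Literature.RingTheory.CohomologyAnnihilator (cohomologyAnnihilator)
open Literature.AlgebraicGeometry.Morphisms Literature.AlgebraicGeometry.Modules
open Literature.AlgebraicGeometry.Resolution Literature.AlgebraicGeometry.Motives
open Summit.ResolutionOfSingularities.ResolutionOfSingularities.Theorems.NoZeno.Birth
open Summit.ResolutionOfSingularities.ResolutionOfSingularities.Theorems.NoZeno.SandwichCluster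

/-- **G4′ = THEOREM A in scheme form (registered stub `stub_caInvertibleMinRes`, skeleton v20/v21 signature):**
`ca(T_m)·𝒪_{X_min}` is invertible along the closed fibre of a minimal resolution of a singular sandwiched stage,
conditionally on the named-fact bundle. [cite: Lipman1969, Theorem (12.1) (ii) (p. 220); IyamaWemyss2010, Thm 2.7] -/
theorem stub_caInvertibleMinRes
    (hF : (Literature.AlgebraicGeometry.Resolution.CossartJannsenSaito2020General.{0} ∧
      Literature.AlgebraicGeometry.Resolution.Lipman1969_1_2.{0} ∧
      Literature.AlgebraicGeometry.Resolution.Lipman1969_4_1.{0} ∧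
      Literature.AlgebraicGeometry.Resolution.Lipman1969_12_1_i.{0} ∧
      Literature.AlgebraicGeometry.Resolution.Lipman1969_12_1_ii.{0} ∧
      Literature.AlgebraicGeometry.Morphisms.GortzWedhorn2023_24_44_H2.{0}))
    (p : ℕ) (_hp : p.Prime) (k K : Type) [Field k] [CharP k p] [Field K]
    [Algebra k K] (O : ValuationSubring K) (A R : Subalgebra k K) (m₀ : ℕ)
    (ctx : SandwichCtx O A R m₀) (m : ℕ) (hm : m₀ + 1 ≤ m)
    (hsing : ¬ IsRegularLocalRing ↥(tower O A m))
    (X : AlgebraicGeometry.Scheme.{0}) (π : X ⟶ AlgebraicGeometry.Spec (CommRingCat.of ↥(tower O A m)))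
    (hπ : Literature.AlgebraicGeometry.Resolution.IsMinimalResolution π) (x : X)
    (hx : IsLocalHom (((X.presheaf.germ ⊤ x trivial).hom.comp
      (π.appTop.hom.comp (AlgebraicGeometry.Scheme.ΓSpecIso (CommRingCat.of ↥(tower O A m))).inv.hom)) :
        ↥(tower O A m) →+* X.presheaf.stalk x)) :
    (Ideal.map (((X.presheaf.germ ⊤ x trivial).hom.comp
      (π.appTop.hom.comp (AlgebraicGeometry.Scheme.ΓSpecIso (CommRingCat.of ↥(tower O A m))).inv.hom)) :
        ↥(tower O A m) →+* X.presheaf.stalk x)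
      (Literature.RingTheory.CohomologyAnnihilator.cohomologyAnnihilator ↥(tower O A m))).IsPrincipal := by
  classical
  obtain ⟨-, h12, -, -, h121ii, hGW⟩ := hF
  obtain ⟨hk, hA, hfr, hAO, htr, -⟩ := id ctx
  -- stage package: noetherian, normal, local, two-dimensional
  obtain ⟨hnoeth, hnorm, hfrT, hloc, hdim2, -, -⟩ := stage_package O A R m₀ ctx m hm hsing
  haveI := hnoeth; haveI := hnorm; haveI := hloc
  -- the resolution: integral, locally noetherian, proper, H¹ = 0, fibres of dimension ≤ 1
  haveI : IsIntegral X := hπ.1.isIntegral_source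
  haveI : IsProper π := hπ.1.isProper
  haveI : IsLocallyNoetherian X := AlgebraicGeometry.LocallyOfFiniteType.isLocallyNoetherian π
  have hrat : HasTrivialCechH1 π := hasTrivialCechH1_of_isResolution_tower h12 O A R m₀ ctx m hm hsing π hπ.1
  have hfib : ∀ y : Spec (.of ↥(tower O A m)), topologicalKrullDim (π.fiber y) ≤ 1 :=
    hπ.1.topologicalKrullDim_fiber_le_one hdim2.le
  -- `ca` is `𝔪`-primary with a non-zero element (stub-5)
  obtain ⟨n, rfl⟩ : ∃ n, m = n + 1 := ⟨m - 1, by omega⟩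
  obtain ⟨c, hc⟩ := exists_maximalIdeal_pow_le_cohomologyAnnihilator_tower O A hk hA hfr hAO htr n
  obtain ⟨y, hy0, hy⟩ := exists_ne_zero_mem_cohomologyAnnihilator_tower O A hk hA hfr hAO htr n hsing
  -- ===== STAND-INS for the inputs in flight =====
  -- (S1) G2-MAIN (stub-8's assembly p512050 `_of_inputs` + stub-1 (iv) p510783 + res-D-pv-024 (vii) p510810), consumed form
  have hG2 : ∀ (M : Type) [AddCommGroup M] [Module ↥(tower O A (n+1)) M] [Module.Finite ↥(tower O A (n+1)) M],
      Module.IsReflexive ↥(tower O A (n+1)) M →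
      (∀ e : Ext (ModuleCat.of ↥(tower O A (n+1)) M) (ModuleCat.of ↥(tower O A (n+1)) ↥(tower O A (n+1))) 1, e = 0) →
      ∃ F : X.Modules, IsAffineLocalizing F ∧
        ∀ (ι : Type) [Finite ι] (U : ι → X.Opens), (∀ i, IsAffineOpen (U i)) → ⨆ i, U i = ⊤ →
          Nonempty (StableEnd ↥(tower O A (n+1)) M ≃ₗ[↥(tower O A (n+1))] CechMH1 π F U) := by
    intro M _ _ _ hM hW
    obtain ⟨F, -, haff, -, hcov⟩ :=
      FullSheaf.exists_locallyFree_stableEnd_equiv_cechMH1_of_inputs π M hπ.1 hM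
        (fun r φ hφ hφinj =>
          FullSheaf.fullSheaf_isFiniteLocallyFree ↥(tower O A (n+1)) X π M φ hdim2 hπ.1 hrat hGW hM hφ hφinj)
        (fun r φ hφ hφinj ι _ U hU hcov =>
          FullSheaf.fullSheaf_dual_cechMH1_subsingleton ↥(tower O A (n+1)) X π M φ hπ.1 hrat hW hφ hφinj U hU hcov)
    exact ⟨F, haff, hcov⟩
  -- (S2) LEMMA L (stub-2, LANDED p506547/p507314), side conditions discharged from the tree
  have hL : ∀ (F : X.Modules), IsAffineLocalizing F →
      ∀ (ι : Type) [Finite ι] (U : ι → X.Opens), (∀ i, IsAffineOpen (U i)) → ⨆ i, U i = ⊤ →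
      ∀ c : ℕ, maximalIdeal ↥(tower O A (n+1)) ^ c ≤ Module.annihilator ↥(tower O A (n+1)) (CechMH1 π F U) →
      ∀ t : ↥(tower O A (n+1)), (∀ η ∈ excPoints π, ∃ a ∈ Module.annihilator ↥(tower O A (n+1)) (CechMH1 π F U),
        a ≠ 0 ∧ Scheme.ord (baseToFunctionField π a) η ≤ Scheme.ord (baseToFunctionField π t) η) →
        t ∈ Module.annihilator ↥(tower O A (n+1)) (CechMH1 π F U) :=
    LemmaL.lemmaL_of_GW π hGW hπ.1 hdim2 hsing
  -- (S3) dictionary (stub-3, LANDED p505497): both indexings of the exceptional curves agree on `X_min`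
  have hdict : excCurvePoints π = excPoints π :=
    (IsResolution.excPoints_eq_excCurvePoints (π := π) hdim2 hπ.1 hsing).symm
  -- ===== the composition (all TREE) =====
  -- right exactness of Ȟ¹ on every finite affine cover is what discharged Lemma L's `hRE` (recorded):
  have _hRE : ∀ {S : ShortComplex X.Modules}, S.ShortExact → IsAffineLocalizing S.X₁ →
      ∀ (ι : Type) [Finite ι] (U : ι → X.Opens), (∀ i, IsAffineOpen (U i)) → ⨆ i, U i = ⊤ →
      Function.Surjective (cechMapH1 π S.g U) :=
    fun hS h1 ι _ U hU hcov => hGW.cechMapH1_surjective π U hfib hS h1 hU hcov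
  -- Ga: `ca(T_m)` is carried
  obtain ⟨Z, hZ⟩ := caCarried_tower_of_inputs O A R m₀ ctx (n+1) hm hsing X π hπ hdim2 hG2 hL hdict c hc y hy0 hy
  -- Gb (stub-9, TREE p506234/p506673): carried ideals of the rational stage are principal at every stalk
  exact carriedPrincipal_tower_of_carried h12 h121ii O A R m₀ ctx (n+1) hm hsing π hπ Z _ hZ x

end Summit.ResolutionOfSingularities.ResolutionOfSingularities.Theorems.NoZeno.SandwichCluster

end
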